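import Mathlib
import HarnessLib
import Literature.Probability.MarkovChains.HeatKernelVarianceDecay
import Literature.Probability.MarkovChains.LogSobolevElementaryBounds

/-!
# The spectral profile `Λ(r)` of a finite Markov chain and the Faber–Krahn inequality for functions `𝓔(u,u)/Var u ≥ ½Λ(4(Eu)²/Var u)` (Goel–Montenegro–Tetali 2006, §1.2, Lemma 2.1, Theorem 2.1 (differential form))

HONEST FRAMING: exact (Metropolis-corrected) sampling algorithms for lattice gauge theory; figures
of merit are autocorrelation/cost numbers at stated couplings and volumes; no continuum-physics claim.

Source (READ on the hub's materialised text): S. Goel, R. Montenegro, P. Tetali, *Mixing time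
bounds via the spectral profile*, Electron. J. Probab. **11** (2006) 1–26 = math.PR/0505690
[GoelMontenegroTetali2006] (held text `paper:arxiv-math_0505690`: §1.1 "Preliminaries", §1.2
"Statement of the main result", §2.1 "Spectral profile bounds").  Everything below is PROVED
(finite state space; 0 named facts).

CONVENTIONS (the tree's): `K = P : Matrix X X ℝ` with `K ≥ 0` entrywise (row-stochastic and
`πK = π` where said), `π` a positive probability vector; `𝓔(f,f) = dirichletForm π P f` (= eq.
(dirichlet) `½Σ_{x,y}[f(x) − f(y)]²K(x,y)π(x)`), `Var = lawVariance π`, `E = lawMean π`, `‖f‖₂² =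
piInner π f f`, the spectral gap `λ₁ = inf_f 𝓔(f,f)/Var(f)` is the tree's `spectralGapR π P`,
`H_t = e^{−t(I−K)}`, `H_tf = heatKernelApp P 1 t f` (`HeatKernelVarianceDecay.lean`); `π(S)` is
written `Σ_{x∈S} π(x)`; "`f` non-constant" is `Var_π(f) > 0` and "`supp f ⊂ S`" is `∀ x ∉ S, f x = 0`.
All infima are real infima over the displayed index sets (value `0` on an empty index set — e.g.
`Λ(r)` for `r < π_*` — which is why the monotonicity / comparison lemmas carry the hypothesis
"some non-empty `S` has `π(S) ≤ r`", i.e. `r ≥ π_*`).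

## Content
* §1.2: **DEFINITION 1.4** `dirichletEigenvalue π P S = λ(S) = inf_{f ∈ c₀⁺(S)} 𝓔(f,f)/Var(f)` and
  `dirichletEigenvalue₀ π P S = λ₀(S) = inf_{f ∈ c₀(S)} 𝓔(f,f)/‖f‖₂²` (the smallest Dirichlet
  eigenvalue of `Δ_S` in the variational form of eq. (lambda_0)); **DEFINITION 1.5**
  `spectralProfile π P r = Λ(r) = inf{λ(S) : S ≠ ∅, π(S) ≤ r}`; non-negativity; the defining
  inequalities `λ(S)Var(f) ≤ 𝓔(f,f)` (`f ∈ c₀⁺(S)`) and `λ₀(S)‖f‖₂² ≤ 𝓔(f,f)` (`f ∈ c₀(S)`); the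
  Faber–Krahn inequality "by construction" `spectralProfile_le_dirichletEigenvalue` (`Λ(π(S)) ≤
  λ(S)`); `spectralProfile_antitone` ("`Λ(r)` is non-increasing"); `spectralGapR_le_spectralProfile`
  ("`Λ(r) ≥ λ₁`").
* §2.1: `dirichletForm_posPart_le` (`𝓔(f,f) ≥ 𝓔(f₊,f₊)`, the part of LEMMA 2.3 used here) and
  **LEMMA 2.1 (the Faber–Krahn inequality for functions)** `GoelMontenegroTetali2006_lemma_2_1`: for
  non-constant `u ≥ 0`, **`𝓔(u,u) ≥ ½Λ(4(Eu)²/Var u)·Var(u)`**, by the printed chain `𝓔(u) ≥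
  𝓔((u−c)₊) ≥ Var((u−c)₊)λ({u>c}) ≥ Var((u−c)₊)Λ(π(u>c))`, `Var((u−c)₊) ≥ Eu² − 2cEu − (Eu)²`,
  `c = Var u/4Eu`, Markov's inequality (`sum_filter_lt_le_lawMean_div`).
* §1.1 eq. (var) / §2.1: `hasDerivAt_lawVariance_heatKernelApp` (**`d/dt Var_π(H_tf) =
  −2𝓔(H_tf,H_tf)`**) and the differential inequality of THEOREM 2.1,
  `GoelMontenegroTetali2006_thm_2_1_diffIneq`: **`I'(t) ≤ −I(t)Λ(4/I(t))`** for `I(t) = Var_π(H_tf)`,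
  `f ≥ 0`, `E_π f = 1` — the printed `u_{x,t} = h(x,·,t) = H_t^*δ_x` is this statement for the
  adjoint chain `K^*` and `f = δ_x = 1_x/π(x)`.

NOT HERE (scope, value-free): eq. (lambda_0) `λ₀(S) ≤ λ(S) ≤ λ₀(S)/(1 − π(S))`, LEMMA 2.2
(`λ₁ ≤ Λ(1/2) ≤ 2λ₁`), the remaining inequalities of LEMMA 2.3 and §2.2 (conductance profile,
LEMMA 2.4) — filed separately; the integrated forms THEOREM 2.1 (`sup_x d²_{2,π}(H_t(x,·),π) ≤
4/V(t)`) and THEOREM 1.1 (`τ_∞(ε) ≤ ∫_{4π_*}^{4/ε} 2dv/(vΛ(v))`); §2.3 (discrete time), §3–§6.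

Context (cell pub-lqcd, venture LatticeQCDFlow; value-free): the spectral profile is the published
device by which "small sets often have large conductance" enters a mixing-time bound — `Λ(r) ≫ λ₁`
for small `r` replaces the uniform `log(1/π_*) ≍ volume` factor of the pure spectral-gap bound
`τ_∞(1/e) ≤ λ₁⁻¹(1 + log(1/π_*))` by `∫ dv/(vΛ(v))`.
-/

namespace Literature.Probability.MarkovChains

open Finset Matrix

variable {X : Type*} [Fintype X] {P : Matrix X X ℝ} {π : X → ℝ}

/-! ## §1.2: `λ(S)`, `λ₀(S)` and the spectral profile `Λ(r)` -/

section Defs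

/-- **DEFINITION 1.4** (Goel–Montenegro–Tetali): for a non-empty `S ⊂ X`,
`λ(S) = inf_{f ∈ c₀⁺(S)} 𝓔(f,f)/Var(f)`, `c₀⁺(S) = {f : supp(f) ⊂ S, f ≥ 0, f ≠ constant}`
(for `π > 0`, "`f` non-constant" is `Var_π(f) > 0`; real infimum, `0` on an empty index set).
[cite: GoelMontenegroTetali2006, §1.2 Definition 1.4] -/
noncomputable def dirichletEigenvalue (π : X → ℝ) (P : Matrix X X ℝ) (S : Finset X) : ℝ :=
  sInf ((fun f : X → ℝ => dirichletForm π P f / lawVariance π f) ''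
    {f | (∀ x, x ∉ S → f x = 0) ∧ (∀ x, 0 ≤ f x) ∧ 0 < lawVariance π f})

/-- The smallest DIRICHLET EIGENVALUE of the restricted Laplacian `Δ_S` in variational form,
`λ₀(S) = inf_{f ∈ c₀(S)} 𝓔_{K_S}(f,f)/‖f‖₂² = inf_{f ∈ c₀(S)} 𝓔_K(f,f)/‖f‖₂²` ("The lower bound is due
to the identity `𝓔_K(f,f) = 𝓔_{K_S}(f,f)` when `f ∈ c₀(S)`"). [cite: GoelMontenegroTetali2006, §1.2
(eq. (lambda_0) and the Courant–Fischer display after Definition 1.4)] -/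
noncomputable def dirichletEigenvalue₀ (π : X → ℝ) (P : Matrix X X ℝ) (S : Finset X) : ℝ :=
  sInf ((fun f : X → ℝ => dirichletForm π P f / piInner π f f) ''
    {f | (∀ x, x ∉ S → f x = 0) ∧ 0 < piInner π f f})

/-- **DEFINITION 1.5** (Goel–Montenegro–Tetali): the SPECTRAL PROFILE
`Λ(r) = inf_{π_* ≤ π(S) ≤ r} λ(S)` (the infimum over the non-empty `S` with `π(S) ≤ r`; real infimum,
`0` when no such `S` exists, i.e. for `r < π_*`). [cite: GoelMontenegroTetali2006, §1.2 Definition 1.5] -/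
noncomputable def spectralProfile (π : X → ℝ) (P : Matrix X X ℝ) (r : ℝ) : ℝ :=
  sInf ((fun S : Finset X => dirichletEigenvalue π P S) '' {S | S.Nonempty ∧ ∑ x ∈ S, π x ≤ r})

/-- `λ(S) ≥ 0`. [cite: GoelMontenegroTetali2006, §1.2 Definition 1.4] -/
theorem dirichletEigenvalue_nonneg (hπ0 : ∀ x, 0 ≤ π x) (hP0 : ∀ x y, 0 ≤ P x y) (S : Finset X) :
    0 ≤ dirichletEigenvalue π P S := by
  refine Real.sInf_nonneg ?_
  rintro _ ⟨f, ⟨-, -, hV⟩, rfl⟩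
  exact div_nonneg (dirichletForm_nonneg hπ0 hP0 f) hV.le

/-- `λ₀(S) ≥ 0`. [cite: GoelMontenegroTetali2006, §1.2 eq. (lambda_0)] -/
theorem dirichletEigenvalue₀_nonneg (hπ0 : ∀ x, 0 ≤ π x) (hP0 : ∀ x y, 0 ≤ P x y) (S : Finset X) :
    0 ≤ dirichletEigenvalue₀ π P S := by
  refine Real.sInf_nonneg ?_
  rintro _ ⟨f, ⟨-, hV⟩, rfl⟩
  exact div_nonneg (dirichletForm_nonneg hπ0 hP0 f) hV.le

/-- `Λ(r) ≥ 0`. [cite: GoelMontenegroTetali2006, §1.2 Definition 1.5] -/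
theorem spectralProfile_nonneg (hπ0 : ∀ x, 0 ≤ π x) (hP0 : ∀ x y, 0 ≤ P x y) (r : ℝ) :
    0 ≤ spectralProfile π P r := by
  refine Real.sInf_nonneg ?_
  rintro _ ⟨S, -, rfl⟩
  exact dirichletEigenvalue_nonneg hπ0 hP0 S

/-- The defining inequality of `λ(S)`: `λ(S)·Var(f) ≤ 𝓔(f,f)` for every `f ≥ 0` supported in `S`.
[cite: GoelMontenegroTetali2006, §1.2 Definition 1.4; §2.1 proof of Lemma 2.1 ("`≥ Var((u−c)₊)
inf_{f ∈ c₀⁺(u>c)} 𝓔(f,f)/Var(f)`")] -/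
theorem dirichletEigenvalue_mul_lawVariance_le (hπ0 : ∀ x, 0 ≤ π x) (hP0 : ∀ x y, 0 ≤ P x y)
    {S : Finset X} {f : X → ℝ} (hsupp : ∀ x, x ∉ S → f x = 0) (hf : ∀ x, 0 ≤ f x) :
    dirichletEigenvalue π P S * lawVariance π f ≤ dirichletForm π P f := by
  have hE := dirichletForm_nonneg hπ0 hP0 f
  rcases (lawVariance_nonneg hπ0 f).eq_or_lt with hV | hV
  · rw [← hV, mul_zero]; exact hE
  · have h : dirichletEigenvalue π P S ≤ dirichletForm π P f / lawVariance π f :=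
      csInf_le ⟨0, by rintro _ ⟨g, ⟨-, -, hg⟩, rfl⟩; exact div_nonneg (dirichletForm_nonneg hπ0 hP0 g) hg.le⟩
        ⟨f, ⟨hsupp, hf, hV⟩, rfl⟩
    exact (le_div_iff₀ hV).1 h

/-- The defining inequality of `λ₀(S)`: `λ₀(S)·‖f‖₂² ≤ 𝓔(f,f)` for every `f` supported in `S`.
[cite: GoelMontenegroTetali2006, §1.2 eq. (lambda_0)] -/
theorem dirichletEigenvalue₀_mul_piInner_le (hπ0 : ∀ x, 0 ≤ π x) (hP0 : ∀ x y, 0 ≤ P x y)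
    {S : Finset X} {f : X → ℝ} (hsupp : ∀ x, x ∉ S → f x = 0) :
    dirichletEigenvalue₀ π P S * piInner π f f ≤ dirichletForm π P f := by
  have hE := dirichletForm_nonneg hπ0 hP0 f
  rcases (piInner_self_nonneg hπ0 f).eq_or_lt with hV | hV
  · rw [← hV, mul_zero]; exact hE
  · have h : dirichletEigenvalue₀ π P S ≤ dirichletForm π P f / piInner π f f :=
      csInf_le ⟨0, by rintro _ ⟨g, ⟨-, hg⟩, rfl⟩; exact div_nonneg (dirichletForm_nonneg hπ0 hP0 g) hg.le⟩
        ⟨f, ⟨hsupp, hV⟩, rfl⟩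
    exact (le_div_iff₀ hV).1 h

/-- The Faber–Krahn inequality of the chain, by construction: `Λ(π(S)) ≤ λ(S)` — indeed
`Λ(r) ≤ λ(S)` whenever `S ≠ ∅` and `π(S) ≤ r`. [cite: GoelMontenegroTetali2006, §1.2 ("by
construction the walk `(K, π)` satisfies the Faber-Krahn inequality `λ(S) ≥ Λ(π(S))`")] -/
theorem spectralProfile_le_dirichletEigenvalue (hπ0 : ∀ x, 0 ≤ π x) (hP0 : ∀ x y, 0 ≤ P x y)
    {S : Finset X} (hS : S.Nonempty) {r : ℝ} (hr : ∑ x ∈ S, π x ≤ r) :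
    spectralProfile π P r ≤ dirichletEigenvalue π P S :=
  csInf_le ⟨0, by rintro _ ⟨T, -, rfl⟩; exact dirichletEigenvalue_nonneg hπ0 hP0 T⟩ ⟨S, ⟨hS, hr⟩, rfl⟩

/-- `Λ` is non-increasing (on `[π_*, ∞)`): if some non-empty `S` has `π(S) ≤ r` and `r ≤ r'` then
`Λ(r') ≤ Λ(r)`. [cite: GoelMontenegroTetali2006, §1.2 ("Observe that `Λ(r)` is non-increasing")] -/
theorem spectralProfile_antitone (hπ0 : ∀ x, 0 ≤ π x) (hP0 : ∀ x y, 0 ≤ P x y) {r r' : ℝ}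
    (hr : ∃ S : Finset X, S.Nonempty ∧ ∑ x ∈ S, π x ≤ r) (hrr : r ≤ r') :
    spectralProfile π P r' ≤ spectralProfile π P r := by
  obtain ⟨S₀, hS₀, hS₀r⟩ := hr
  refine le_csInf ⟨_, ⟨S₀, ⟨hS₀, hS₀r⟩, rfl⟩⟩ ?_
  rintro _ ⟨S, ⟨hS, hSr⟩, rfl⟩
  exact spectralProfile_le_dirichletEigenvalue hπ0 hP0 hS (hSr.trans hrr)

/-- On a space with at least two points every non-empty `S` carries a non-constant `f ≥ 0`
supported in `S` (the indicator of a point of `S`), so `c₀⁺(S) ≠ ∅`. [cite: GoelMontenegroTetali2006,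
§1.2 Definition 1.4 ("For a non-empty subset `S ⊂ X`")] -/
theorem exists_mem_c0plus [Nontrivial X] [DecidableEq X] (hπ : ∀ x, 0 < π x) (hπ1 : ∑ x, π x = 1)
    {S : Finset X} (hS : S.Nonempty) :
    ∃ f : X → ℝ, (∀ x, x ∉ S → f x = 0) ∧ (∀ x, 0 ≤ f x) ∧ 0 < lawVariance π f := by
  obtain ⟨x₀, hx₀⟩ := hS
  refine ⟨fun x => if x = x₀ then 1 else 0, fun x hx => if_neg (fun h : x = x₀ => hx (by rw [h]; exact hx₀)),
    fun x => by by_cases h : x = x₀ <;> simp [h], ?_⟩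
  -- `Var_π(1_{x₀}) = π(x₀)(1 − π(x₀)) > 0`
  obtain ⟨y, hy⟩ := exists_ne x₀
  have hlt : π x₀ < 1 := by
    have h2 : π x₀ + π y ≤ 1 := by
      rw [← hπ1, ← sum_pair (Ne.symm hy)]
      exact sum_le_univ_sum_of_nonneg fun z => (hπ z).le
    linarith [hπ y]
  have hm : lawMean π (fun x => if x = x₀ then (1:ℝ) else 0) = π x₀ := by
    simp [lawMean]
  unfold lawVariance
  rw [hm]
  have hx₀term : 0 < π x₀ * ((if x₀ = x₀ then (1:ℝ) else 0) - π x₀) ^ 2 := by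
    rw [if_pos rfl]
    exact mul_pos (hπ x₀) (by nlinarith)
  exact lt_of_lt_of_le hx₀term (single_le_sum (f := fun x => π x * ((if x = x₀ then (1:ℝ) else 0) - π x₀) ^ 2)
    (fun x _ => mul_nonneg (hπ x).le (sq_nonneg _)) (mem_univ x₀))

/-- `Λ(r) ≥ λ₁`: the spectral profile dominates the spectral gap `λ₁ = inf_f 𝓔(f,f)/Var(f)` (the
tree's `spectralGapR`), for every `r ≥ π_*` (some non-empty `S` has `π(S) ≤ r`; `|X| ≥ 2`).
[cite: GoelMontenegroTetali2006, §1.2 ("Observe that `Λ(r)` is non-increasing, and `Λ(r) ≥ λ₁`")] -/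
theorem spectralGapR_le_spectralProfile [Nontrivial X] [DecidableEq X] (hπ : ∀ x, 0 < π x)
    (hπ1 : ∑ x, π x = 1) (hP0 : ∀ x y, 0 ≤ P x y) {r : ℝ}
    (hr : ∃ S : Finset X, S.Nonempty ∧ ∑ x ∈ S, π x ≤ r) :
    spectralGapR π P ≤ spectralProfile π P r := by
  have hπ0 : ∀ x, 0 ≤ π x := fun x => (hπ x).le
  obtain ⟨S₀, hS₀, hS₀r⟩ := hr
  refine le_csInf ⟨_, ⟨S₀, ⟨hS₀, hS₀r⟩, rfl⟩⟩ ?_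
  rintro _ ⟨S, ⟨hS, -⟩, rfl⟩
  obtain ⟨f₀, hf₀⟩ := exists_mem_c0plus hπ hπ1 hS
  refine le_csInf ⟨_, ⟨f₀, hf₀, rfl⟩⟩ ?_
  rintro _ ⟨f, ⟨-, -, hV⟩, rfl⟩
  rw [le_div_iff₀ hV]
  exact spectralGapR_mul_lawVariance_le' hπ0 hπ1 hP0 f

end Defs

/-! ## §2.1: Lemma 2.3 (`𝓔(f,f) ≥ 𝓔(f₊,f₊)`) and Lemma 2.1 (the Faber–Krahn inequality for functions) -/

section FaberKrahn

/-- `𝓔(f,f) ≥ 𝓔(f₊,f₊)` ("`∀ a, b ∈ ℝ: (a−b)² ≥ (a₊−b₊)²` so `𝓔(f,f) ≥ 𝓔(f₊,f₊)`").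
[cite: GoelMontenegroTetali2006, §2.1 proof of Lemma 2.1; Lemma 2.3] -/
theorem dirichletForm_posPart_le (hπ0 : ∀ x, 0 ≤ π x) (hP0 : ∀ x y, 0 ≤ P x y) (f : X → ℝ) :
    dirichletForm π P (fun x => max (f x) 0) ≤ dirichletForm π P f := by
  unfold dirichletForm
  refine mul_le_mul_of_nonneg_left (sum_le_sum fun x _ => sum_le_sum fun y _ => ?_) (by norm_num)
  refine mul_le_mul_of_nonneg_left ?_ (mul_nonneg (hπ0 x) (hP0 x y))
  -- `(a₊ − b₊)² ≤ (a − b)²`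
  have h : |max (f x) 0 - max (f y) 0| ≤ |f x - f y| := abs_max_sub_max_le_abs (f x) (f y) 0
  rw [← sq_abs (max (f x) 0 - max (f y) 0), ← sq_abs (f x - f y)]
  exact pow_le_pow_left₀ (abs_nonneg _) h 2

/-- Markov's inequality under `π`: `π{u > c} ≤ E_π(u)/c` for `u ≥ 0`, `c > 0`.
[cite: GoelMontenegroTetali2006, §2.1 proof of Lemma 2.1 ("apply Markov's inequality
`π(u > c) < (Eu)/c`")] -/
theorem sum_filter_lt_le_lawMean_div [DecidableEq X] (hπ0 : ∀ x, 0 ≤ π x) {u : X → ℝ}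
    (hu : ∀ x, 0 ≤ u x) {c : ℝ} (hc : 0 < c) :
    ∑ x ∈ univ.filter (fun x => c < u x), π x ≤ lawMean π u / c := by
  rw [le_div_iff₀ hc, sum_mul]
  calc ∑ x ∈ univ.filter (fun x => c < u x), π x * c
      ≤ ∑ x ∈ univ.filter (fun x => c < u x), π x * u x :=
        sum_le_sum fun x hx => mul_le_mul_of_nonneg_left (le_of_lt (mem_filter.1 hx).2) (hπ0 x)
    _ ≤ ∑ x, π x * u x :=
        sum_le_univ_sum_of_nonneg fun x => mul_nonneg (hπ0 x) (hu x)

/-- `E_π(u²) = Var_π(u) + (E_π u)²`. [cite: GoelMontenegroTetali2006, §2.1 proof of Lemma 2.1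
("`Var((u−c)₊) = E(u−c)₊² − (E(u−c)₊)² ≥ Eu² − 2cEu − (Eu)²`")] -/
theorem piInner_self_eq_lawVariance_add_sq (hπ1 : ∑ x, π x = 1) (u : X → ℝ) :
    piInner π u u = lawVariance π u + lawMean π u ^ 2 := by
  have h := piInner_sub_const_eq hπ1 u 0
  simp only [sub_zero] at h
  exact h

/-- **LEMMA 2.1 (Goel–Montenegro–Tetali 2006): the Faber–Krahn inequality for functions.**  For
every non-constant `u : X → ℝ₊` (`π` a positive probability vector, `K ≥ 0`):
**`𝓔(u,u)/Var(u) ≥ ½ Λ(4(Eu)²/Var(u))`**, typed multiplied out.  Proof as printed: `𝓔(u,u) ≥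
𝓔((u−c)₊,(u−c)₊) ≥ Var((u−c)₊)·λ({u > c}) ≥ Var((u−c)₊)·Λ(π(u > c))`, `Var((u−c)₊) ≥ Eu² − 2cEu −
(Eu)²`, `c = Var(u)/4Eu`, Markov's inequality `π(u > c) ≤ Eu/c`.
[cite: GoelMontenegroTetali2006, §2.1 Lemma 2.1] -/
theorem GoelMontenegroTetali2006_lemma_2_1 [DecidableEq X] (hπ : ∀ x, 0 < π x)
    (hπ1 : ∑ x, π x = 1) (hP0 : ∀ x y, 0 ≤ P x y) {u : X → ℝ} (hu : ∀ x, 0 ≤ u x)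
    (hV : 0 < lawVariance π u) :
    (1 / 2) * spectralProfile π P (4 * lawMean π u ^ 2 / lawVariance π u) * lawVariance π u ≤
      dirichletForm π P u := by
  have hπ0 : ∀ x, 0 ≤ π x := fun x => (hπ x).le
  set V := lawVariance π u with hVdef
  set m := lawMean π u with hm
  -- `E u > 0` (a non-negative function with positive variance is not identically zero)
  have hm0 : 0 < m := by
    rcases (sum_nonneg fun x _ => mul_nonneg (hπ0 x) (hu x) : 0 ≤ lawMean π u).eq_or_lt with h0 | h0
    · exfalso
      have hu0 : ∀ x, u x = 0 := by
        intro x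
        have := (sum_eq_zero_iff_of_nonneg fun y _ => mul_nonneg (hπ0 y) (hu y)).1 h0.symm x (mem_univ x)
        rcases mul_eq_zero.1 this with h1 | h1
        · exact absurd h1 (hπ x).ne'
        · exact h1
      have : V = 0 := by
        rw [hVdef]; unfold lawVariance lawMean; simp [hu0]
      linarith
    · exact h0
  set c := V / (4 * m) with hc
  have hc0 : 0 < c := by positivity
  set S := univ.filter (fun x => c < u x) with hS
  set g : X → ℝ := fun x => max (u x - c) 0 with hg
  have hg0 : ∀ x, 0 ≤ g x := fun x => le_max_right _ _
  have hgsupp : ∀ x, x ∉ S → g x = 0 := by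
    intro x hx
    have : ¬ c < u x := fun h => hx (mem_filter.2 ⟨mem_univ x, h⟩)
    exact max_eq_right (by linarith [not_lt.1 this])
  -- `𝓔(u) = 𝓔(u − c) ≥ 𝓔((u − c)₊)`
  have hE : dirichletForm π P g ≤ dirichletForm π P u := by
    rw [← dirichletForm_sub_const π P u c]
    exact dirichletForm_posPart_le hπ0 hP0 _
  -- `Var((u − c)₊) ≥ Var(u) − 2c·Eu = Var(u)/2`
  have hVg : V / 2 ≤ lawVariance π g := by
    have h1 : piInner π g g = lawVariance π g + lawMean π g ^ 2 := piInner_self_eq_lawVariance_add_sq hπ1 g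
    have h2 : piInner π u u = V + m ^ 2 := piInner_self_eq_lawVariance_add_sq hπ1 u
    -- pointwise `(a − c)₊² ≥ a² − 2ca` and `(a − c)₊ ≤ a`
    have hpt : ∀ x, u x * u x - 2 * c * u x ≤ g x * g x := by
      intro x
      by_cases hx : c ≤ u x
      · have : g x = u x - c := max_eq_left (by linarith)
        rw [this]; nlinarith
      · have : g x = 0 := max_eq_right (by linarith)
        rw [this]; nlinarith [hu x]
    have hle : ∀ x, g x ≤ u x := fun x => max_le (by linarith) (hu x)
    have h3 : piInner π u u - 2 * c * m ≤ piInner π g g := by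
      simp only [piInner, hm, lawMean]
      rw [mul_sum, ← sum_sub_distrib]
      exact sum_le_sum fun x _ => by nlinarith [hpt x, hπ0 x]
    have h4 : lawMean π g ^ 2 ≤ m ^ 2 := by
      have hmg0 : 0 ≤ lawMean π g := sum_nonneg fun x _ => mul_nonneg (hπ0 x) (hg0 x)
      have hmg : lawMean π g ≤ m := sum_le_sum fun x _ => mul_le_mul_of_nonneg_left (hle x) (hπ0 x)
      exact pow_le_pow_left₀ hmg0 hmg 2
    have h5 : 2 * c * m = V / 2 := by rw [hc]; field_simp; ring
    linarith
  have hVg0 : 0 ≤ lawVariance π g := lawVariance_nonneg hπ0 g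
  -- `S ≠ ∅` (else `(u − c)₊ = 0` has zero variance) and Markov: `π(S) ≤ Eu/c = 4(Eu)²/Var u`
  have hSne : S.Nonempty := by
    by_contra hSe
    rw [not_nonempty_iff_eq_empty] at hSe
    have hg' : ∀ x, g x = 0 := fun x => hgsupp x (by rw [hSe]; exact notMem_empty x)
    have : lawVariance π g = 0 := by unfold lawVariance lawMean; simp [hg']
    linarith
  have hπS : ∑ x ∈ S, π x ≤ 4 * m ^ 2 / V := by
    refine (sum_filter_lt_le_lawMean_div hπ0 hu hc0).trans (le_of_eq ?_)
    rw [← hm, hc, div_div_eq_mul_div]; ring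
  -- assemble
  have hΛ : spectralProfile π P (4 * m ^ 2 / V) ≤ dirichletEigenvalue π P S :=
    spectralProfile_le_dirichletEigenvalue hπ0 hP0 hSne hπS
  have hΛ0 : 0 ≤ spectralProfile π P (4 * m ^ 2 / V) := spectralProfile_nonneg hπ0 hP0 _
  have hlam := dirichletEigenvalue_mul_lawVariance_le hπ0 hP0 hgsupp hg0
  calc 1 / 2 * spectralProfile π P (4 * m ^ 2 / V) * V
      = spectralProfile π P (4 * m ^ 2 / V) * (V / 2) := by ring
    _ ≤ spectralProfile π P (4 * m ^ 2 / V) * lawVariance π g := mul_le_mul_of_nonneg_left hVg hΛ0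
    _ ≤ dirichletEigenvalue π P S * lawVariance π g := mul_le_mul_of_nonneg_right hΛ hVg0
    _ ≤ dirichletForm π P g := hlam
    _ ≤ dirichletForm π P u := hE

end FaberKrahn

/-! ## §1.1 eq. (var): `d/dt Var(H_tf) = −2𝓔(H_tf,H_tf)` and the differential inequality of Theorem 2.1 -/

section VarianceDecay

variable [DecidableEq X]

/-- `H_tf ≥ 0` for `f ≥ 0`, `t ≥ 0`. [cite: GoelMontenegroTetali2006, §1.1 ("`H_t(x,y) =
e^{−t}Σ_n tⁿ/n! Kⁿ(x,y)`")] -/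
theorem heatKernelApp_nonneg (hP : IsRowStochastic P) {t : ℝ} (ht : 0 ≤ t) {f : X → ℝ}
    (hf : ∀ x, 0 ≤ f x) (x : X) : 0 ≤ heatKernelApp P 1 t f x :=
  sum_nonneg fun y _ => mul_nonneg (heatKernel_nonneg hP (by simpa using ht) x y) (hf y)

/-- **`d/dt Var_π(H_tf) = −2𝓔(H_tf, H_tf)`** for the semigroup `H_t = e^{−t(I−K)}` acting on
functions (`π` stationary; `E_π(H_tf) = E_π(f)` is constant in `t`).  The printed display is for
the density `u_{x,t} = h(x,·,t) = H_t^*δ_x`, i.e. this identity for the adjoint chain `K^*`.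
[cite: GoelMontenegroTetali2006, §1.1 eq. (var) ("`d/dt Var(u_{x,t}) = −2𝓔(u_{x,t},u_{x,t})`")] -/
theorem hasDerivAt_lawVariance_heatKernelApp (hP : IsRowStochastic P) (hst : IsStationary π P)
    (f : X → ℝ) (t : ℝ) :
    HasDerivAt (fun s : ℝ => lawVariance π (heatKernelApp P 1 s f))
      (-(2 * dirichletForm π P (heatKernelApp P 1 t f))) t := by
  have hshift : ∀ s, heatKernelApp P 1 s (fun x => f x - lawMean π f) =
      fun x => heatKernelApp P 1 s f x - lawMean π f :=
    fun s => funext fun x => heatKernelApp_sub_const hP 1 s f _ x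
  have hvar : ∀ s, lawVariance π (heatKernelApp P 1 s f) =
      piInner π (heatKernelApp P 1 s (fun x => f x - lawMean π f))
        (heatKernelApp P 1 s (fun x => f x - lawMean π f)) := by
    intro s
    rw [hshift s, ← lawMean_heatKernelApp hst 1 s f, piInner_centred_eq_lawVariance]
  have hdir : dirichletForm π P (heatKernelApp P 1 t (fun x => f x - lawMean π f)) =
      dirichletForm π P (heatKernelApp P 1 t f) := by
    rw [hshift t, dirichletForm_sub_const]
  have h := hasDerivAt_piInner_heatKernelApp hP hst 1 (fun x => f x - lawMean π f) t
  rw [hdir] at h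
  have e : (fun s : ℝ => lawVariance π (heatKernelApp P 1 s f)) = fun s =>
      piInner π (heatKernelApp P 1 s (fun x => f x - lawMean π f))
        (heatKernelApp P 1 s (fun x => f x - lawMean π f)) := funext hvar
  rw [e]
  simpa using h

/-- **The differential inequality of Theorem 2.1, eq. (diffeq): `I'(t) = −2𝓔(u_t,u_t) ≤
−I(t)Λ(4/I(t))`** for `u_t = H_tf` with `f ≥ 0`, `E_π(f) = 1` and `I(t) = Var_π(H_tf) > 0`
(Lemma 2.1 applied to `u_t ≥ 0`, `E u_t = 1`).  The printed `u_{x,t} = h(x,·,t)` is the case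
`f = δ_x = 1_x/π(x)` for the adjoint chain `K^*`. [cite: GoelMontenegroTetali2006, §2.1 Theorem 2.1
(proof: "`I_x'(t) = −2𝓔(u_{x,t},u_{x,t}) ≤ −I_xΛ(4/I_x)`")] -/
theorem GoelMontenegroTetali2006_thm_2_1_diffIneq (hπ : ∀ x, 0 < π x) (hπ1 : ∑ x, π x = 1)
    (hP : IsRowStochastic P) {f : X → ℝ} (hf : ∀ x, 0 ≤ f x) (hst : IsStationary π P)
    (hf1 : lawMean π f = 1) {t : ℝ} (ht : 0 ≤ t) (hV : 0 < lawVariance π (heatKernelApp P 1 t f)) :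
    -(2 * dirichletForm π P (heatKernelApp P 1 t f)) ≤
      -(lawVariance π (heatKernelApp P 1 t f) *
        spectralProfile π P (4 / lawVariance π (heatKernelApp P 1 t f))) := by
  have h := GoelMontenegroTetali2006_lemma_2_1 hπ hπ1 hP.1 (heatKernelApp_nonneg hP ht hf) hV
  rw [lawMean_heatKernelApp hst 1 t f, hf1, one_pow, mul_one] at h
  linarith

end VarianceDecay

end Literature.Probability.MarkovChains
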